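import Summits.ResolutionOfSingularities.ResolutionOfSingularities.Theorems.EquisingularLiftEquisingularLiftNatDirDictCriterion
import Literature.AlgebraicGeometry.Resolution.IdealSheafFlatDescent
import HarnessLib

/-!
# [OURS · L1 W4.5(b) · EL♮(3)] DIRDICT (a) part 3 — SECTION ⇒ DIRECTION: a section curve `Γ` of the exceptional `ℙ¹`-bundle of the
# blow-up of the carrier curve IS the centre of a DIRECTION `𝒟 = Ī ⊓ υ_*(𝓘⟨Γ⟩·𝓔)` along the carrier

Crux chain w45b (cell `res-hironaka`, slot W4.5(b)), working crux **EL♮** = stmt-ResolutionOfSingularities-20038, child **EL♮(3)** =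
stmt-ResolutionOfSingularities-20148, route EquisingularLift, line `sections`; registered stubs `stub_elnat_ratDirZeroPointResolution`
(rung DIR₀₀) and `stub_elnat_ratTowerPointResolution` (TOWER₀, Čech-witnessed rounds); object **DIRDICT (a)** (res-L1-w45b-plan-1
RULING-6 17:51:04Z / WORD (α) 17:58:13Z / NO OBJECTION 18:12:58Z; currency (α) CHARTWISE ROOTED = res-L1-w45b-stub-2's T-DIRLIFT ideal
currency D1–D4; typed sig `L/res-D-pv-051/TARGET-DIRDICT-a.sig.lean` a58a21689f0a0f38). Part 3 = the GLOBAL half of (a) (res-L1-w45b-plan-1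
COLLISION GUARD 18:28:21Z / RULING 18:58:54Z), after parts 1–2 (…NatDirDictAdaptedFrame p555912, …NatDirDictCriterion p558327). CITATION RULE OF
RECORD: the POINTWISE engine «section ⇒ frame with `𝒟_z = (ℓ) + (m²)` / `stalkIdeal (controlledTransform …) = P`» is res-L1-w45b-stub-2's
T-DIRLIFT B0 `exists_frame_stalkIdeal_directionCentre_eq_of_section` (…NatDirectionOfSection, p556107) — **pointwise engine: see B0 p556107**;
this file and part 2 are to be cited only for the GLOBAL statements (the ideal SHEAF `𝒟`, `Ī·Ī ≤ 𝒟 ≤ Ī`, `controlledTransform υ Ī 𝒟 1 = 𝓘⟨Γ⟩`).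
HONEST FRAMING: OURS; NOT a statement of any manuscript; AI-written, weaker than expert review. No `sorry`;
standard axioms. DEF-FREE. `--supports stmt-ResolutionOfSingularities-20148 --as helper`.

SETTING (root-local, downstairs only). `υ : G₁ → G` a blowing up along `Ī = 𝓘⟨Z⟩` (universally closed), the carrier curve `Z̃ = V(Ī)`
having quasi-regular 2-frames at its points (`hfr`), `E = υ⁻¹Z`, `Γ ⊆ E` closed with an isomorphism `Γ̃ ⟶ Z̃` over `υ` (`DirStepSec`
read at the root where `E` was born).

WHAT (namespace `…Cruxes.EquisingularLiftNat.Sections`).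
* `map_stalkIdeal_map_le` — `υ♯_y ((υ_*K)_{υ y}) ⊆ K_y` (Galois connection `comap_map_le` on stalks).
* `eq_of_section_of_apply_eq` — the point of the section over a point of the carrier is unique.
* `exists_section_mem_ideal_of_mem_stalkIdeal` — a germ in `I_x` is the germ of a section of `I` over an affine neighbourhood.
* `mem_stalkIdeal_map_of_section` — **the pushforward stalk at a point of the carrier**: a germ `g ∈ Ī_z` whose pull-back at THE point
  `y₀ ∈ Γ` over `z` lies in `(𝓘⟨Γ⟩·𝓔)_{y₀}` lies in `(υ_*(𝓘⟨Γ⟩·𝓔))_z` (the condition is automatic off `Γ`, open along `Γ`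
  — `exists_basicOpen_forall_germ_mem_stalkIdeal` — and `υ` is CLOSED, so a neighbourhood of `z` avoids the bad points of `Γ`; then
  Literature `mem_map_ideal_iff`).
* `exists_adaptedData_of_section` — at `y₀ ∈ Γ`: an adapted frame `(ℓ, m)` (part 1) with `𝒟_{υ y₀} = (ℓ) + (m²)` for
  `𝒟 = Ī ⊓ υ_*(𝓘⟨Γ⟩·𝓔)`.
* **`exists_direction_of_section`** — DIRDICT (a): `∃ 𝒟, Ī·Ī ≤ 𝒟 ≤ Ī`, quasi-regular frames `𝒟_z = (ℓ) + (m²)` at every `z ∈ Z`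
  (= T-DIRLIFT D3's `hdir` with `I.support = Z`), and `controlledTransform υ Ī 𝒟 1 = 𝓘⟨Γ⟩` (part 2's criterion).

References: The Stacks Project, Tags 0804, 01HJ (ideal sheaf of the image); Görtz–Wedhorn I (13.19) — through the tree (parts 1–2; Literature
`IdealSheafFlatDescent.mem_map_ideal_iff`, `mem_ideal_iff_forall_germ_mem_stalkIdeal`, `KollarEtaleNeighbourhood.exists_basicOpen_forall_germ_mem_stalkIdeal`,
`HypersurfaceTransform.appLE_germ`, `MarkedIdealsLemmas`, `StalkIdealLemmas`; Mathlib `IdealSheafData.map` / `le_map_iff_comap_le`,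
`Scheme.Hom.isClosedMap`).
-/

noncomputable section

open CategoryTheory AlgebraicGeometry TopologicalSpace IsLocalRing
open Literature.AlgebraicGeometry.Resolution
open AlgebraicGeometry.Scheme.IdealSheafData

set_option linter.dupNamespace false -- mandated namespace `Summit.<Summit>.<Problem>` of this single-conjunct summit

namespace Summit.ResolutionOfSingularities.ResolutionOfSingularities.Cruxes.EquisingularLiftNat.Sections

universe u

/-! ## 1. Generalities: pushforward stalks, sections of an ideal, the point of a section -/

section General

variable {G₁ G : Scheme.{u}} {υ : G₁ ⟶ G}

/-- **`υ♯_y ((υ_*K)_{υ y}) ⊆ K_y`**: the stalk of the pushforward ideal `K.map υ` at `υ y` maps into the stalk of `K` at `y`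
(`(K.map υ).comap υ ≤ K`). [folklore] -/
theorem map_stalkIdeal_map_le (K : G₁.IdealSheafData) (y : G₁) :
    (stalkIdeal (K.map υ) (υ y)).map (υ.stalkMap y).hom ≤ stalkIdeal K y := by
  rw [← stalkIdeal_comap_eq_map_stalkMap]
  exact stalkIdeal_mono (Scheme.IdealSheafData.comap_map_le K υ) y

/-- **The point of a section over a point of the base is unique**: for an isomorphism `δ : V(IΓ) ⟶ V(IZ)` over `υ`, two points of
`V(IΓ)` with the same image in `G` coincide. [folklore] -/
theorem eq_of_section_of_apply_eq {IΓ : G₁.IdealSheafData} {IZ : G.IdealSheafData}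
    (δ : IΓ.subscheme ⟶ IZ.subscheme) [IsIso δ] (hδ : δ ≫ IZ.subschemeι = IΓ.subschemeι ≫ υ)
    {y₁ y₂ : ↥IΓ.subscheme} (h : υ (IΓ.subschemeι y₁) = υ (IΓ.subschemeι y₂)) : y₁ = y₂ := by
  have h1 : IZ.subschemeι (δ y₁) = IZ.subschemeι (δ y₂) := by
    rw [← Scheme.Hom.comp_apply, ← Scheme.Hom.comp_apply, hδ, Scheme.Hom.comp_apply, Scheme.Hom.comp_apply, h]
  have h2 : δ y₁ = δ y₂ := IZ.subschemeι.isClosedEmbedding.injective h1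
  have h3 := congrArg (fun w => (inv δ) w) h2
  dsimp only at h3
  rwa [inv_apply_apply, inv_apply_apply] at h3

/-- **A germ in `I_x` is the germ of a SECTION OF `I`** over some affine neighbourhood inside any given open neighbourhood. [folklore] -/
theorem exists_section_mem_ideal_of_mem_stalkIdeal {X : Scheme.{u}} (I : X.IdealSheafData) {x : X} {U₀ : X.Opens} (hxU₀ : x ∈ U₀)
    (g : X.presheaf.stalk x) (hg : g ∈ stalkIdeal I x) :
    ∃ (U : X.affineOpens) (hxU : x ∈ (U : X.Opens)) (s : Γ(X, U)),
      (U : X.Opens) ≤ U₀ ∧ s ∈ I.ideal U ∧ (X.presheaf.germ U x hxU).hom s = g := by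
  obtain ⟨V, hxV, t, ht⟩ := TopCat.Presheaf.exists_germ_eq X.presheaf g
  obtain ⟨W, hW, hxW, hWle⟩ := exists_isAffineOpen_mem_and_subset (show x ∈ V ⊓ U₀ from ⟨hxV, hxU₀⟩)
  have hWV : W ≤ V := fun _ h => (hWle h).1
  set t' := (X.presheaf.map (homOfLE hWV).op).hom t with ht'
  have hgt' : (X.presheaf.germ W x hxW).hom t' = g := by
    rw [ht', TopCat.Presheaf.germ_res_apply]; exact ht
  obtain ⟨f, hxf, hf⟩ := exists_basicOpen_forall_germ_mem_stalkIdeal I ⟨W, hW⟩ hxW t' (hgt'.symm ▸ hg)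
  have hDW : X.basicOpen f ≤ W := X.basicOpen_le f
  refine ⟨⟨X.basicOpen f, hW.basicOpen f⟩, hxf, (X.presheaf.map (homOfLE hDW).op).hom t', ?_, ?_, ?_⟩
  · exact fun _ h => (hWle (hDW h)).2
  · rw [mem_ideal_iff_forall_germ_mem_stalkIdeal]
    intro y hy
    have h := TopCat.Presheaf.germ_res_apply X.presheaf (homOfLE hDW) y hy t'
    exact h.symm ▸ hf y hy
  · have h := TopCat.Presheaf.germ_res_apply X.presheaf (homOfLE hDW) x hxf t'
    exact h.trans hgt'

/-- Germs of `υ^*` of a section: `(υ^{*}_{U,W} s)_v = υ_v^* (s_{υ v})`. [folklore] -/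
theorem germ_appLE_apply (U : G.Opens) (W : G₁.Opens) (hle : W ≤ υ ⁻¹ᵁ U) (v : G₁) (hv : v ∈ W) (s : Γ(G, U)) :
    (G₁.presheaf.germ W v hv).hom (υ.appLE U W hle s) = (υ.stalkMap v).hom ((G.presheaf.germ U (υ v) (hle hv)).hom s) := by
  rw [← CommRingCat.comp_apply, appLE_germ]; rfl

/-- **The pushforward stalk at a point of the carrier.** `υ : G₁ → G` universally closed, `δ : V(IΓ) ≅ V(IZ)` over `υ` (a section),
`IΓ.support ⊆ υ⁻¹(IZ.support)`, `y₀ ∈ V(IΓ)`. A germ `g ∈ (IZ)_{υ y₀}` with `υ♯ g ∈ (IΓ · IZ𝒪_{G₁})_{y₀}` lies in the stalk of the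
pushforward `(υ_*(IΓ · IZ𝒪_{G₁}))_{υ y₀}`: the membership condition holds at every point over a neighbourhood of `υ y₀` — automatically
off `IΓ.support`, on a neighbourhood of `y₀` by openness, and the remaining points of `IΓ.support` have CLOSED image not containing `υ y₀`.
[cite: StacksProject, Tag 01HJ] -/
theorem mem_stalkIdeal_map_of_section [UniversallyClosed υ] {IΓ : G₁.IdealSheafData} {IZ : G.IdealSheafData}
    (δ : IΓ.subscheme ⟶ IZ.subscheme) [IsIso δ] (hδ : δ ≫ IZ.subschemeι = IΓ.subschemeι ≫ υ)
    (y₀' : ↥IΓ.subscheme) (g : G.presheaf.stalk (υ (IΓ.subschemeι y₀')))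
    (hgZ : g ∈ stalkIdeal IZ (υ (IΓ.subschemeι y₀')))
    (hg : (υ.stalkMap (IΓ.subschemeι y₀')).hom g ∈ stalkIdeal (IΓ * IZ.comap υ) (IΓ.subschemeι y₀')) :
    g ∈ stalkIdeal ((IΓ * IZ.comap υ).map υ) (υ (IΓ.subschemeι y₀')) := by
  -- a section `s ∈ IZ(U)` representing `g`
  obtain ⟨U, hzU, s, -, hsZ, hsg⟩ :=
    exists_section_mem_ideal_of_mem_stalkIdeal IZ (Opens.mem_top (υ (IΓ.subschemeι y₀'))) g hgZ
  -- the membership condition at a point `v` over `U`, off the section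
  have hoff : ∀ (v : G₁) (hv : υ v ∈ (U : G.Opens)), v ∉ IΓ.support →
      (υ.stalkMap v).hom ((G.presheaf.germ U (υ v) hv).hom s) ∈ stalkIdeal (IΓ * IZ.comap υ) v := by
    intro v hv hvΓ
    rw [stalkIdeal_mul, stalkIdeal_eq_top_of_not_mem_support hvΓ, Ideal.top_mul, stalkIdeal_comap_eq_map_stalkMap]
    exact Ideal.mem_map_of_mem _ (map_germ_le_stalkIdeal IZ U hv (Ideal.mem_map_of_mem _ hsZ))
  -- upstairs: an affine `W₀ ∋ y₀` over `U` and the pulled-back section; the good basic open `D ∋ y₀`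
  have hy₀U : IΓ.subschemeι y₀' ∈ υ ⁻¹ᵁ (U : G.Opens) := hzU
  obtain ⟨W₀, hW₀, hy₀W₀, hW₀le⟩ := exists_isAffineOpen_mem_and_subset hy₀U
  have hle : W₀ ≤ υ ⁻¹ᵁ (U : G.Opens) := hW₀le
  set t := υ.appLE U W₀ hle s with ht
  have hgt : (G₁.presheaf.germ W₀ (IΓ.subschemeι y₀') hy₀W₀).hom t ∈ stalkIdeal (IΓ * IZ.comap υ) (IΓ.subschemeι y₀') := by
    rw [ht, germ_appLE_apply, hsg]; exact hg
  obtain ⟨f, hy₀f, hD⟩ := exists_basicOpen_forall_germ_mem_stalkIdeal (IΓ * IZ.comap υ) ⟨W₀, hW₀⟩ hy₀W₀ t hgt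
  -- the bad set: points of the section off `D`; its image is closed and misses `υ y₀`
  set C : Set G₁ := (IΓ.support : Set G₁) ∩ (G₁.basicOpen f : Set G₁)ᶜ with hC
  have hCcl : IsClosed C := IΓ.support.isClosed.inter (G₁.basicOpen f).2.isClosed_compl
  have hυC : IsClosed (υ '' C) := υ.isClosedMap _ hCcl
  have hzC : υ (IΓ.subschemeι y₀') ∉ υ '' C := by
    rintro ⟨v, ⟨hvΓ, hvD⟩, hv⟩
    obtain ⟨w, rfl⟩ := (mem_range_subschemeι_iff IΓ v).mpr hvΓ
    have hw : w = y₀' := eq_of_section_of_apply_eq δ hδ hv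
    subst hw
    exact hvD hy₀f
  -- an affine neighbourhood `U' ∋ υ y₀` inside `U` avoiding `υ '' C`
  obtain ⟨U', hU', hzU', hU'le⟩ := exists_isAffineOpen_mem_and_subset
    (show υ (IΓ.subschemeι y₀') ∈ (U : G.Opens) ⊓ ⟨(υ '' C)ᶜ, hυC.isOpen_compl⟩ from ⟨hzU, hzC⟩)
  have hU'U : U' ≤ (U : G.Opens) := fun _ h => (hU'le h).1
  set s' := (G.presheaf.map (homOfLE hU'U).op).hom s with hs'
  -- `s' ∈ (K.map υ)(U')`
  have hs'mem : s' ∈ ((IΓ * IZ.comap υ).map υ).ideal ⟨U', hU'⟩ := by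
    rw [mem_map_ideal_iff]
    intro v hv
    have hvU : υ v ∈ (U : G.Opens) := hU'U hv
    have hgerm : (G₁.presheaf.germ (υ ⁻¹ᵁ U') v hv).hom ((υ.app U').hom s') =
        (υ.stalkMap v).hom ((G.presheaf.germ U (υ v) hvU).hom s) := by
      rw [← Scheme.Hom.germ_stalkMap_apply, hs']
      exact congrArg _ (TopCat.Presheaf.germ_res_apply G.presheaf (homOfLE hU'U) (υ v) hv s)
    rw [hgerm]
    by_cases hvΓ : v ∈ IΓ.support
    · -- a point of the section over `U'` is not in `C`, hence in `D`
      have hvD : v ∈ G₁.basicOpen f := by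
        by_contra hvD
        exact (hU'le hv).2 ⟨v, ⟨hvΓ, hvD⟩, rfl⟩
      have h := hD v hvD
      rwa [ht, germ_appLE_apply] at h
    · exact hoff v hvU hvΓ
  -- conclude at the stalk
  have hg' : (G.presheaf.germ U' (υ (IΓ.subschemeι y₀')) hzU').hom s' = g := by
    rw [hs']
    exact (TopCat.Presheaf.germ_res_apply G.presheaf (homOfLE hU'U) _ hzU' s).trans hsg
  rw [← hg']
  exact map_germ_le_stalkIdeal ((IΓ * IZ.comap υ).map υ) ⟨U', hU'⟩ hzU' (Ideal.mem_map_of_mem _ hs'mem)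

end General

/-! ## 2. The direction of a section -/

section Direction

variable {G₁ G : Scheme.{u}} {υ : G₁ ⟶ G}

/-- `I · I ≤ I` for ideal sheaves. [folklore] -/
theorem mul_le_self (I : G.IdealSheafData) : I * I ≤ I := by
  intro U
  rw [Scheme.IdealSheafData.ideal_mul, Pi.mul_apply]
  exact Ideal.mul_le_right

/-- `Ī·Ī ≤ Ī ⊓ υ_*(IΓ · Ī𝒪_{G₁})` when `Ī𝒪_{G₁} ≤ IΓ` (`V(IΓ) ⊆ υ⁻¹V(Ī)` scheme-theoretically). [folklore] -/
theorem mul_le_inf_map (IΓ : G₁.IdealSheafData) (IZ : G.IdealSheafData) (hE : IZ.comap υ ≤ IΓ) :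
    IZ * IZ ≤ IZ ⊓ (IΓ * IZ.comap υ).map υ := by
  refine le_inf (mul_le_self IZ) ?_
  rw [Scheme.IdealSheafData.le_map_iff_comap_le, comap_mul]
  intro U
  rw [Scheme.IdealSheafData.ideal_mul, Scheme.IdealSheafData.ideal_mul, Pi.mul_apply, Pi.mul_apply]
  exact Ideal.mul_mono_left (hE U)

/-- **The adapted data at a point of the section, for the direction `𝒟 = Ī ⊓ υ_*(IΓ·𝓔)`.** `υ` a universally closed blowing up along
`IZ`, `δ : V(IΓ) ≅ V(IZ)` over `υ`, `IZ𝒪_{G₁} ≤ IΓ`, quasi-regular 2-frames of `IZ` at the points of its support. Then at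
`y₀ = ι y₀'`: a quasi-regular frame `c = (ℓ, m)` of `(IZ)_{υ y₀}`, a chart-`m` presentation `(𝔔, χ)` of `𝒪_{G₁,y₀}` with `χ(ℓ/m) ∈ (IΓ)_{y₀}`,
and `𝒟_{υ y₀} = (ℓ) + (m²)`. [cite: StacksProject, Tag 0804] -/
theorem exists_adaptedData_of_section [UniversallyClosed υ] {IΓ : G₁.IdealSheafData} {IZ : G.IdealSheafData}
    (hυ : IsBlowup υ IZ) (δ : IΓ.subscheme ⟶ IZ.subscheme) [IsIso δ] (hδ : δ ≫ IZ.subschemeι = IΓ.subschemeι ≫ υ)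
    (hE : IZ.comap υ ≤ IΓ)
    (hfr : ∀ z ∈ IZ.support, ∃ c : Fin 2 → G.presheaf.stalk z, Ideal.span (Set.range c) = stalkIdeal IZ z ∧ IsQuasiRegular c)
    (y₀' : ↥IΓ.subscheme) :
    ∃ (c : Fin 2 → G.presheaf.stalk (υ (IΓ.subschemeι y₀')))
      (𝔔 : PrimeSpectrum (blowupAlgebra (Ideal.span (Set.range c)) (c 1)))
      (χ : blowupAlgebra (Ideal.span (Set.range c)) (c 1) →+* G₁.presheaf.stalk (IΓ.subschemeι y₀')),
      Ideal.span (Set.range c) = stalkIdeal IZ (υ (IΓ.subschemeι y₀')) ∧ IsQuasiRegular c ∧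
      stalkIdeal (IZ ⊓ (IΓ * IZ.comap υ).map υ) (υ (IΓ.subschemeι y₀')) = Ideal.span {c 0} ⊔ Ideal.span {c 1 * c 1} ∧
      (∀ a, χ (algebraMap _ _ a) = (υ.stalkMap (IΓ.subschemeι y₀')).hom a) ∧
      @IsLocalization.AtPrime _ _ (G₁.presheaf.stalk (IΓ.subschemeι y₀')) _ χ.toAlgebra 𝔔.asIdeal _ ∧
      𝔔.asIdeal.comap (algebraMap _ (blowupAlgebra (Ideal.span (Set.range c)) (c 1))) =
        maximalIdeal (G.presheaf.stalk (υ (IΓ.subschemeι y₀'))) ∧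
      χ (blowupAlgebra.frac c 1 0) ∈ stalkIdeal IΓ (IΓ.subschemeι y₀') := by
  have hΓE : IΓ.support ≤ (IZ.comap υ).support := Scheme.IdealSheafData.support_antitone hE
  have hzZ : υ (IΓ.subschemeι y₀') ∈ IZ.support := by
    have h : IΓ.subschemeι y₀' ∈ (IZ.comap υ).support := hΓE (subschemeι_apply_mem_support IΓ y₀')
    rwa [Scheme.IdealSheafData.support_comap] at h
  obtain ⟨c₀, hc₀, hqr₀⟩ := hfr _ hzZ
  obtain ⟨hsurj, hker⟩ := surjective_and_ker_mk_comp_stalkMap_of_section δ hδ y₀'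
  obtain ⟨c, 𝔔, χ, hc, hqr, hχ, hloc, h𝔔, hgen, hfrac⟩ :=
    exists_sectionAdaptedFrame hυ (IΓ.subschemeι y₀') (stalkIdeal IΓ (IΓ.subschemeι y₀')) hsurj c₀ hc₀ hqr₀
  refine ⟨c, 𝔔, χ, hc, hqr, ?_, hχ, hloc, h𝔔, hfrac⟩
  -- the exceptional generator and the fraction
  have hnzd : (υ.stalkMap (IΓ.subschemeι y₀')).hom (c 1) ∈ nonZeroDivisors _ :=
    mem_nonZeroDivisors_of_stalkIdeal_comap_eq_span hυ _ hgen
  have hmul : χ (blowupAlgebra.frac c 1 0) * (υ.stalkMap (IΓ.subschemeι y₀')).hom (c 1) =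
      (υ.stalkMap (IΓ.subschemeι y₀')).hom (c 0) := apply_frac_mul c 1 0 χ _ hχ
  have hKy : stalkIdeal (IΓ * IZ.comap υ) (IΓ.subschemeι y₀') =
      stalkIdeal IΓ (IΓ.subschemeι y₀') * Ideal.span {(υ.stalkMap (IΓ.subschemeι y₀')).hom (c 1)} := by
    rw [stalkIdeal_mul, hgen]
  have hc0Z : c 0 ∈ stalkIdeal IZ (υ (IΓ.subschemeι y₀')) := by rw [← hc]; exact Ideal.subset_span (Set.mem_range_self 0)
  have hc1Z : c 1 ∈ stalkIdeal IZ (υ (IΓ.subschemeι y₀')) := by rw [← hc]; exact Ideal.subset_span (Set.mem_range_self 1)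
  apply le_antisymm
  · -- `𝒟_z ⊆ (ℓ) + (m²)`
    intro g hg
    rw [stalkIdeal_inf, Submodule.mem_inf] at hg
    obtain ⟨hgZ, hgK⟩ := hg
    have hφg : (υ.stalkMap (IΓ.subschemeι y₀')).hom g ∈
        stalkIdeal IΓ (IΓ.subschemeι y₀') * Ideal.span {(υ.stalkMap (IΓ.subschemeι y₀')).hom (c 1)} := by
      rw [← hKy]; exact map_stalkIdeal_map_le _ _ (Ideal.mem_map_of_mem _ hgK)
    rw [← hc, span_range_fin_two, Ideal.mem_span_pair] at hgZ
    obtain ⟨a, b, rfl⟩ := hgZ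
    obtain ⟨p, hp, hpg⟩ := Ideal.mem_mul_span_singleton.mp hφg
    -- `p · φ m = φ(a ℓ + b m) = (φ a · χ(ℓ/m) + φ b) · φ m`
    have h1 : p * (υ.stalkMap (IΓ.subschemeι y₀')).hom (c 1) =
        ((υ.stalkMap (IΓ.subschemeι y₀')).hom a * χ (blowupAlgebra.frac c 1 0) + (υ.stalkMap (IΓ.subschemeι y₀')).hom b) *
          (υ.stalkMap (IΓ.subschemeι y₀')).hom (c 1) := by
      rw [hpg, map_add, map_mul, map_mul, ← hmul]; ring
    have h2 := (mul_cancel_right_mem_nonZeroDivisors hnzd).mp h1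
    have hb : (υ.stalkMap (IΓ.subschemeι y₀')).hom b ∈ stalkIdeal IΓ (IΓ.subschemeι y₀') := by
      have h : (υ.stalkMap (IΓ.subschemeι y₀')).hom b =
          p - (υ.stalkMap (IΓ.subschemeι y₀')).hom a * χ (blowupAlgebra.frac c 1 0) := by rw [h2]; ring
      rw [h]
      exact Ideal.sub_mem _ hp (Ideal.mul_mem_left _ _ hfrac)
    have hb' : b ∈ Ideal.span (Set.range c) := by
      rw [hc, ← hker, RingHom.mem_ker, RingHom.comp_apply, Ideal.Quotient.eq_zero_iff_mem]; exact hb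
    rw [span_range_fin_two, Ideal.mem_span_pair] at hb'
    obtain ⟨a', b', rfl⟩ := hb'
    rw [Ideal.mem_span_singleton_sup]
    refine ⟨a + a' * c 1, b' * (c 1 * c 1), Ideal.mul_mem_left _ _ (Ideal.mem_span_singleton_self _), by ring⟩
  · -- `(ℓ) + (m²) ⊆ 𝒟_z`
    have hII : IZ * IZ ≤ IZ ⊓ (IΓ * IZ.comap υ).map υ := mul_le_inf_map IΓ IZ hE
    refine sup_le ?_ ?_ <;> rw [Ideal.span_singleton_le_iff_mem]
    · rw [stalkIdeal_inf, Submodule.mem_inf]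
      refine ⟨hc0Z, ?_⟩
      refine mem_stalkIdeal_map_of_section δ hδ y₀' (c 0) hc0Z ?_
      rw [hKy, ← hmul]
      exact Ideal.mul_mem_mul hfrac (Ideal.mem_span_singleton_self _)
    · refine stalkIdeal_mono hII _ ?_
      rw [stalkIdeal_mul]
      exact Ideal.mul_mem_mul hc1Z hc1Z

/-- **DIRDICT (a) — SECTION ⇒ DIRECTION.** `υ : G₁ → G` a universally closed blowing up along `Ī = 𝓘⟨Z⟩` whose stalks at the points of `Z`
have quasi-regular 2-frames, `Γ ⊆ υ⁻¹Z` closed with an isomorphism `Γ̃ ⟶ Z̃` over `υ` (`DirStepSec` at the root). Then there is a DIRECTION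
`𝒟` along `Ī` — `Ī·Ī ≤ 𝒟 ≤ Ī`, at every `z ∈ Z` a quasi-regular frame `(ℓ, m)` of `Ī_z` with `𝒟_z = (ℓ) + (m²)` (T-DIRLIFT's `hdir`) —
whose weight-one controlled transform (the direction centre of D1–D4) IS the reduced section curve: `controlledTransform υ Ī 𝒟 1 = 𝓘⟨Γ⟩`.
Namely `𝒟 = Ī ⊓ υ_*(𝓘⟨Γ⟩ · Ī𝒪_{G₁})`. [cite: StacksProject, Tag 0804] [cite: BierstoneGrigorievMilmanWlodarczyk2011, §3.2] -/
theorem exists_direction_of_section [UniversallyClosed υ] (Z : Set G) (hZ : IsClosed Z)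
    (hυ : IsBlowup υ (vanishingIdeal (⟨Z, hZ⟩ : Closeds G)))
    (hfr : ∀ z ∈ Z, ∃ c : Fin 2 → G.presheaf.stalk z,
      Ideal.span (Set.range c) = stalkIdeal (vanishingIdeal (⟨Z, hZ⟩ : Closeds G)) z ∧ IsQuasiRegular c)
    (Γ : Set G₁) (hΓ : IsClosed Γ) (hΓZ : Γ ⊆ υ ⁻¹' Z)
    (hsec : ∃ δ : (vanishingIdeal (⟨Γ, hΓ⟩ : Closeds G₁)).subscheme ⟶ (vanishingIdeal (⟨Z, hZ⟩ : Closeds G)).subscheme,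
      δ ≫ (vanishingIdeal (⟨Z, hZ⟩ : Closeds G)).subschemeι = (vanishingIdeal (⟨Γ, hΓ⟩ : Closeds G₁)).subschemeι ≫ υ ∧ IsIso δ) :
    ∃ 𝒟 : G.IdealSheafData,
      vanishingIdeal (⟨Z, hZ⟩ : Closeds G) * vanishingIdeal (⟨Z, hZ⟩ : Closeds G) ≤ 𝒟 ∧
      𝒟 ≤ vanishingIdeal (⟨Z, hZ⟩ : Closeds G) ∧
      (∀ z ∈ Z, ∃ c : Fin 2 → G.presheaf.stalk z,
        Ideal.span (Set.range c) = stalkIdeal (vanishingIdeal (⟨Z, hZ⟩ : Closeds G)) z ∧ IsQuasiRegular c ∧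
        stalkIdeal 𝒟 z = Ideal.span {c 0} ⊔ Ideal.span {c 1 * c 1}) ∧
      controlledTransform υ (vanishingIdeal (⟨Z, hZ⟩ : Closeds G)) 𝒟 1 = vanishingIdeal (⟨Γ, hΓ⟩ : Closeds G₁) := by
  set IZ := vanishingIdeal (⟨Z, hZ⟩ : Closeds G) with hIZ
  set IΓ := vanishingIdeal (⟨Γ, hΓ⟩ : Closeds G₁) with hIΓ
  obtain ⟨δ, hδ, hδiso⟩ := hsec
  haveI := hδiso
  have hE : IZ.comap υ ≤ IΓ := by
    rw [hIΓ, ← Scheme.IdealSheafData.le_support_iff_le_vanishingIdeal]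
    intro y hy
    rw [Scheme.IdealSheafData.support_comap]
    change υ y ∈ IZ.support
    rw [mem_support_vanishingIdeal_iff]
    exact hΓZ hy
  have hfr' : ∀ z ∈ IZ.support, ∃ c : Fin 2 → G.presheaf.stalk z, Ideal.span (Set.range c) = stalkIdeal IZ z ∧ IsQuasiRegular c :=
    fun z hz => hfr z ((mem_support_vanishingIdeal_iff Z hZ z).mp hz)
  refine ⟨IZ ⊓ (IΓ * IZ.comap υ).map υ, mul_le_inf_map IΓ IZ hE, inf_le_left, fun z hz => ?_, ?_⟩
  · -- the frame at `z`: over `z` sits the point `y₀` of the section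
    obtain ⟨y₀', hy₀⟩ := exists_mem_support_of_section δ hδ (z := z) (by rw [mem_support_vanishingIdeal_iff]; exact hz)
    subst hy₀
    obtain ⟨c, -, -, hc, hqr, h𝒟, -⟩ := exists_adaptedData_of_section hυ δ hδ hE hfr' y₀'
    exact ⟨c, hc, hqr, h𝒟⟩
  · -- the centre, by the criterion of part 2
    refine controlledTransform_eq_vanishingIdeal_of_adapted Z hZ hυ Γ hΓ hΓZ ⟨δ, hδ, hδiso⟩ _ (mul_le_inf_map IΓ IZ hE) ?_
    intro y hy
    obtain ⟨y₀', rfl⟩ := (mem_range_subschemeι_iff IΓ y).mpr ((mem_support_vanishingIdeal_iff Γ hΓ y).mpr hy)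
    obtain ⟨c, 𝔔, χ, hc, hqr, h𝒟, hχ, hloc, h𝔔, hfrac⟩ := exists_adaptedData_of_section hυ δ hδ hE hfr' y₀'
    exact ⟨c, 𝔔, χ, hc, hqr, h𝒟, hχ, hloc, h𝔔, hfrac⟩

end Direction

end Summit.ResolutionOfSingularities.ResolutionOfSingularities.Cruxes.EquisingularLiftNat.Sections

end
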